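import Literature.Combinatorics.Additive.SliceRankMethod
import HarnessLib

/-!
# Slice rank of tensors with antichain support: the Sawin–Tao lower bound

Topic `Literature/Combinatorics/Additive` (companion of `SliceRankMethod.lean`). W. Sawin and T. Tao,
*Notes on the "slice rank" of tensors* (T. Tao's blog *What's new*, 24 August 2016), Proposition 4,
lower bound (5): if a `3`-tensor `D : X × Y × Z → K` is written in bases indexed by `X, Y, Z`, each
index set carries a total (pre)order, and the support `Γ = {D ≠ 0}` is an ANTICHAIN for the product
order, then

  `slice-rank(D) ≥ min { |π₁(Γ₁)| + |π₂(Γ₂)| + |π₃(Γ₃)| : Γ = Γ₁ ∪ Γ₂ ∪ Γ₃ }`,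

the minimum number of slices needed to cover the support (the matching upper bound (4) holds for every
tensor; in the tree: `hasSliceRankLE_of_cover`, `Literature.Barriers.MatrixMultiplication.sliceRank_le_of_block`).
This generalises Tao's diagonal lemma (`HasSliceRankLE.card_le_of_diagonal`) and is the tool by which
full slice rank of direct sums of matrix multiplication tensors — hence of semisimple group algebras,
Blasiak–Church–Cohn–Grochow–Umans 2017, Cor. B.7 — is proved in
`Literature/Barriers/MatrixMultiplication/NilpotentGroupBarrierSemisimple.lean`.

## Content (all PROVED)

* `exists_annihilator_subspace` — the annihilator `U ≤ K^X` of `k` slice functions has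
  `dim U ≥ |X| - k` (Sawin–Tao, Lemma 1 (iv)).
* `exists_leadingTerms` — Gaussian elimination: for a subspace `U ≤ K^X` and a key `e : X → L` into a
  linear order, the set `A` of LEADING coordinates (an `x` such that some `u ∈ U` has `u x ≠ 0` and
  vanishes at every coordinate of larger key) has `|A| ≥ dim U`.
* `HasSliceRankLE.exists_zeroBox_of_antichain` — **Prop. 4, lower bound**, in the complementary
  ("zero box") form: if `D` has a slice decomposition with `k` slices and its support is an antichain for
  keys `ex, ey, ez`, then there are `A ⊆ X`, `B ⊆ Y`, `C ⊆ Z` with `D = 0` on `A × B × C` and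
  `|X| + |Y| + |Z| ≤ k + |A| + |B| + |C|`. (A zero box `A × B × C` is the same thing as the cover
  `Γ₁ = {x ∉ A}, Γ₂ = {y ∉ B}, Γ₃ = {z ∉ C}` of `Γ`, of cost `≤ |X∖A| + |Y∖B| + |Z∖C|`; so this is (5).)

## Proof (as in the blog post)

From a decomposition `D = Σᵣ f₁ʳ(x)g₁ʳ(y,z) + Σᵣ f₂ʳ(y)g₂ʳ(x,z) + Σᵣ f₃ʳ(z)g₃ʳ(x,y)` with
`kx + ky + kz ≤ k` terms, the annihilators `U, V, W` of the `f₁ʳ, f₂ʳ, f₃ʳ` have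
`dim U + dim V + dim W ≥ |X| + |Y| + |Z| - k` and the trilinear form `Σ u(x)v(y)w(z)D(x,y,z)` vanishes
on `U × V × W` (push the decomposition through, `sum_trilinear_eq_zero`). Let `A, B, C` be the leading
coordinates of `U, V, W`. If `(x₀,y₀,z₀) ∈ A × B × C` were in the support, pick `u, v, w` with these
leading coordinates: every other triple `(x,y,z)` in `supp u × supp v × supp w` is `≤ (x₀,y₀,z₀)`
coordinatewise, hence off the support (antichain), so the trilinear form equals
`u(x₀)v(y₀)w(z₀)D(x₀,y₀,z₀) ≠ 0` — a contradiction.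

## References

* W. Sawin, T. Tao, *Notes on the "slice rank" of tensors*, What's new (blog), 24 August 2016,
  https://terrytao.wordpress.com/2016/08/24/notes-on-the-slice-rank-of-tensors/ — Lemma 1, Prop. 4
  (read via the public WordPress API, 2026-08-15). [SawinTao2016]
* J. Blasiak, T. Church, H. Cohn, J. A. Grochow, E. Naslund, W. F. Sawin, C. Umans, *On cap sets and
  the group-theoretic approach to matrix multiplication*, Discrete Analysis 2017:3, Lemma 4.7 (Tao's
  diagonal lemma, the special case). [BlasiakChurchCohnGrochowNaslundSawinUmans2017]
-/

noncomputable section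

open scoped BigOperators
open Module Finset

namespace Literature.Combinatorics.Additive

variable {K : Type*} [Field K] {X Y Z : Type*}

/-- **Annihilator of the slice functions** (Sawin–Tao 2016, Lemma 1 (iv), one coordinate): for
`k` functions `fᵢ : X → K` there is a subspace `U ≤ K^X` with `Σₐ u(a) fᵢ(a) = 0` for all `u ∈ U`
and all `i`, of dimension `≥ |X| - k` (the kernel of `u ↦ (Σₐ fᵢ(a) u(a))ᵢ`, rank–nullity).
[cite: SawinTao2016, Lemma 1] -/
theorem exists_annihilator_subspace [Fintype X] {k : ℕ} (f : Fin k → X → K) :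
    ∃ U : Submodule K (X → K), (∀ u ∈ U, ∀ i, ∑ a, u a * f i a = 0) ∧
      Fintype.card X ≤ finrank K U + k := by
  classical
  let F : Matrix (Fin k) X K := Matrix.of fun i a => f i a
  refine ⟨LinearMap.ker F.mulVecLin, fun u hu i => ?_, ?_⟩
  · have h := congr_fun (LinearMap.mem_ker.1 hu) i
    simp only [Matrix.mulVecLin_apply, Matrix.mulVec, dotProduct, F, Matrix.of_apply,
      Pi.zero_apply] at h
    rw [← h]
    exact Finset.sum_congr rfl fun a _ => mul_comm _ _
  · have h := LinearMap.finrank_range_add_finrank_ker F.mulVecLin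
    have hr : finrank K (LinearMap.range F.mulVecLin) ≤ k :=
      (Submodule.finrank_le _).trans (by simp)
    rw [Module.finrank_fintype_fun_eq_card] at h
    omega

/-- **The trilinear form of a slice decomposition vanishes on the annihilators**: if
`Σₓ u(x) f₁ⁱ(x) = 0`, `Σ_y v(y) f₂ⁱ(y) = 0`, `Σ_z w(z) f₃ⁱ(z) = 0` for all `i`, then
`Σ_{x,y,z} u(x) v(y) w(z) · (Σᵢ f₁ⁱ(x)g₁ⁱ(y,z) + Σᵢ f₂ⁱ(y)g₂ⁱ(x,z) + Σᵢ f₃ⁱ(z)g₃ⁱ(x,y)) = 0`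
(Sawin–Tao 2016, Lemma 1, (iii) ⇒ (iv): "`v` is orthogonal to `⨂ⱼ Wⱼ`"). [cite: SawinTao2016, Lemma 1] -/
theorem sum_trilinear_eq_zero [Fintype X] [Fintype Y] [Fintype Z] {kx ky kz : ℕ}
    (f₁ : Fin kx → X → K) (g₁ : Fin kx → Y → Z → K) (f₂ : Fin ky → Y → K)
    (g₂ : Fin ky → X → Z → K) (f₃ : Fin kz → Z → K) (g₃ : Fin kz → X → Y → K)
    (u : X → K) (v : Y → K) (w : Z → K) (hu : ∀ i, ∑ x, u x * f₁ i x = 0)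
    (hv : ∀ i, ∑ y, v y * f₂ i y = 0) (hw : ∀ i, ∑ z, w z * f₃ i z = 0) :
    ∑ x, ∑ y, ∑ z, u x * v y * w z *
        ((∑ i, f₁ i x * g₁ i y z) + (∑ i, f₂ i y * g₂ i x z) + (∑ i, f₃ i z * g₃ i x y)) = 0 := by
  -- each of the three parts vanishes once the annihilated variable is summed innermost
  have hP : ∀ y z, ∑ x, u x * v y * w z * ∑ i, f₁ i x * g₁ i y z = 0 := by
    intro y z
    simp_rw [Finset.mul_sum]
    rw [Finset.sum_comm]
    refine Finset.sum_eq_zero fun i _ => ?_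
    calc ∑ x, u x * v y * w z * (f₁ i x * g₁ i y z)
        = (v y * w z * g₁ i y z) * ∑ x, u x * f₁ i x := by
          rw [Finset.mul_sum]
          exact Finset.sum_congr rfl fun x _ => by ring
      _ = 0 := by rw [hu i, mul_zero]
  have hQ : ∀ x z, ∑ y, u x * v y * w z * ∑ i, f₂ i y * g₂ i x z = 0 := by
    intro x z
    simp_rw [Finset.mul_sum]
    rw [Finset.sum_comm]
    refine Finset.sum_eq_zero fun i _ => ?_
    calc ∑ y, u x * v y * w z * (f₂ i y * g₂ i x z)
        = (u x * w z * g₂ i x z) * ∑ y, v y * f₂ i y := by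
          rw [Finset.mul_sum]
          exact Finset.sum_congr rfl fun y _ => by ring
      _ = 0 := by rw [hv i, mul_zero]
  have hR : ∀ x y, ∑ z, u x * v y * w z * ∑ i, f₃ i z * g₃ i x y = 0 := by
    intro x y
    simp_rw [Finset.mul_sum]
    rw [Finset.sum_comm]
    refine Finset.sum_eq_zero fun i _ => ?_
    calc ∑ z, u x * v y * w z * (f₃ i z * g₃ i x y)
        = (u x * v y * g₃ i x y) * ∑ z, w z * f₃ i z := by
          rw [Finset.mul_sum]
          exact Finset.sum_congr rfl fun z _ => by ring
      _ = 0 := by rw [hw i, mul_zero]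
  have e1 : ∑ x, ∑ y, ∑ z, u x * v y * w z * ∑ i, f₁ i x * g₁ i y z = 0 := by
    rw [Finset.sum_comm]
    refine Finset.sum_eq_zero fun y _ => ?_
    rw [Finset.sum_comm]
    exact Finset.sum_eq_zero fun z _ => hP y z
  have e2 : ∑ x, ∑ y, ∑ z, u x * v y * w z * ∑ i, f₂ i y * g₂ i x z = 0 := by
    refine Finset.sum_eq_zero fun x _ => ?_
    rw [Finset.sum_comm]
    exact Finset.sum_eq_zero fun z _ => hQ x z
  have e3 : ∑ x, ∑ y, ∑ z, u x * v y * w z * ∑ i, f₃ i z * g₃ i x y = 0 :=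
    Finset.sum_eq_zero fun x _ => Finset.sum_eq_zero fun y _ => hR x y
  simp only [mul_add, Finset.sum_add_distrib, e1, e2, e3, add_zero]

/-- **Leading coordinates** (the Gaussian-elimination step in the proof of Sawin–Tao 2016, Prop. 4:
a basis of `U` in row-echelon form has `dim U` distinct pivots): for a subspace `U ≤ K^X` and a key
`e : X → L` into a linear order, let `A` be the set of coordinates `x` such that some `u ∈ U` has
`u(x) ≠ 0` and `u(x') = 0` whenever `e(x') > e(x)`. Then `dim U ≤ |A|`: restriction to the
coordinates in `A` is injective on `U`, since a non-zero `u ∈ U` does not vanish at its own leading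
coordinate, which lies in `A`. [cite: SawinTao2016, Prop. 4 (proof)] -/
theorem exists_leadingTerms [Fintype X] {L : Type*} [LinearOrder L] (e : X → L)
    (U : Submodule K (X → K)) :
    ∃ A : Finset X, (∀ x ∈ A, ∃ u ∈ U, u x ≠ 0 ∧ ∀ x', e x < e x' → u x' = 0) ∧
      finrank K U ≤ A.card := by
  classical
  let A : Finset X := univ.filter fun x => ∃ u ∈ U, u x ≠ 0 ∧ ∀ x', e x < e x' → u x' = 0
  refine ⟨A, fun x hx => (mem_filter.1 hx).2, ?_⟩
  -- restriction to the coordinates in `A` is injective on `U`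
  let ρ : U →ₗ[K] (A → K) := (LinearMap.funLeft K K ((↑) : A → X)) ∘ₗ U.subtype
  have hρ : Function.Injective ρ := by
    rw [← LinearMap.ker_eq_bot, Submodule.eq_bot_iff]
    intro u hu
    by_contra hne
    have hne' : (u : X → K) ≠ 0 := fun h => hne (Subtype.ext h)
    obtain ⟨x₁, hx₁⟩ : ∃ x, (u : X → K) x ≠ 0 := by
      by_contra hall
      push Not at hall
      exact hne' (funext hall)
    obtain ⟨x₀, hx₀S, hmax⟩ := (univ.filter fun x => (u : X → K) x ≠ 0).exists_max_image e
      ⟨x₁, by simpa using hx₁⟩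
    have hx₀ : (u : X → K) x₀ ≠ 0 := by simpa using hx₀S
    have habove : ∀ x', e x₀ < e x' → (u : X → K) x' = 0 := by
      intro x' hlt
      by_contra h
      exact absurd (hmax x' (by simpa using h)) (not_le.2 hlt)
    have hx₀A : x₀ ∈ A := mem_filter.2 ⟨mem_univ _, u, u.2, hx₀, habove⟩
    have h0 := congr_fun (LinearMap.mem_ker.1 hu) ⟨x₀, hx₀A⟩
    simp only [ρ, LinearMap.coe_comp, Function.comp_apply, Submodule.coe_subtype,
      LinearMap.funLeft_apply, Pi.zero_apply] at h0
    exact hx₀ h0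
  calc finrank K U ≤ finrank K (A → K) := LinearMap.finrank_le_finrank_of_injective hρ
    _ = A.card := by simp

/-- **Sawin–Tao 2016, Proposition 4 (lower bound (5)), zero-box form.** Let `D : X × Y × Z → K`
have a slice decomposition with `k` slices (`HasSliceRankLE D k`), and let `ex, ey, ez` be keys into
linear orders for which the support of `D` is an antichain: `D(x,y,z) ≠ 0`, `D(x',y',z') ≠ 0`,
`ex x ≤ ex x'`, `ey y ≤ ey y'`, `ez z ≤ ez z'` force `(x,y,z) = (x',y',z')`. Then there is a box
`A × B × C` on which `D` vanishes with `|X| + |Y| + |Z| ≤ k + |A| + |B| + |C|` — equivalently, the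
slices `{x} × Y × Z (x ∉ A)`, `X × {y} × Z (y ∉ B)`, `X × Y × {z} (z ∉ C)` cover the support at cost
`≤ k`, which is the printed form "`rank(v) ≥ min_{Γ = Γ₁ ∪ Γ₂ ∪ Γ₃} |π₁(Γ₁)| + |π₂(Γ₂)| + |π₃(Γ₃)|`".
Proof as printed (annihilators, leading coordinates, isolation of the leading triple); see the
module docstring. [cite: SawinTao2016, Prop. 4] -/
theorem HasSliceRankLE.exists_zeroBox_of_antichain [Fintype X] [Fintype Y] [Fintype Z]
    {Lx Ly Lz : Type*} [LinearOrder Lx] [LinearOrder Ly] [LinearOrder Lz]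
    (ex : X → Lx) (ey : Y → Ly) (ez : Z → Lz) {D : X → Y → Z → K} {k : ℕ}
    (hD : HasSliceRankLE D k)
    (hanti : ∀ x y z x' y' z', D x y z ≠ 0 → D x' y' z' ≠ 0 → ex x ≤ ex x' → ey y ≤ ey y' →
      ez z ≤ ez z' → x = x' ∧ y = y' ∧ z = z') :
    ∃ (A : Finset X) (B : Finset Y) (C : Finset Z), (∀ x ∈ A, ∀ y ∈ B, ∀ z ∈ C, D x y z = 0) ∧
      Fintype.card X + Fintype.card Y + Fintype.card Z ≤ k + A.card + B.card + C.card := by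
  obtain ⟨kx, ky, kz, hk, f₁, g₁, f₂, g₂, f₃, g₃, hdec⟩ := hD
  obtain ⟨U, hU, hUdim⟩ := exists_annihilator_subspace f₁
  obtain ⟨V, hV, hVdim⟩ := exists_annihilator_subspace f₂
  obtain ⟨W, hW, hWdim⟩ := exists_annihilator_subspace f₃
  obtain ⟨A, hA, hAU⟩ := exists_leadingTerms ex U
  obtain ⟨B, hB, hBV⟩ := exists_leadingTerms ey V
  obtain ⟨C, hC, hCW⟩ := exists_leadingTerms ez W
  refine ⟨A, B, C, fun x₀ hx₀ y₀ hy₀ z₀ hz₀ => ?_, by omega⟩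
  obtain ⟨u, huU, hux, hua⟩ := hA x₀ hx₀
  obtain ⟨v, hvV, hvy, hva⟩ := hB y₀ hy₀
  obtain ⟨w, hwW, hwz, hwa⟩ := hC z₀ hz₀
  by_contra hD0
  -- the trilinear form `Σ u(x) v(y) w(z) D(x,y,z)` vanishes on `U × V × W`
  have htri : ∑ x, ∑ y, ∑ z, u x * v y * w z * D x y z = 0 := by
    have hlhs : ∑ x, ∑ y, ∑ z, u x * v y * w z * D x y z =
        ∑ x, ∑ y, ∑ z, u x * v y * w z *
          ((∑ i, f₁ i x * g₁ i y z) + (∑ i, f₂ i y * g₂ i x z) + (∑ i, f₃ i z * g₃ i x y)) :=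
      Finset.sum_congr rfl fun x _ => Finset.sum_congr rfl fun y _ =>
        Finset.sum_congr rfl fun z _ => by rw [hdec x y z]
    rw [hlhs]
    exact sum_trilinear_eq_zero f₁ g₁ f₂ g₂ f₃ g₃ u v w (hU u huU) (hV v hvV) (hW w hwW)
  -- only the leading triple can contribute
  have hvan : ∀ x y z, ¬ (x = x₀ ∧ y = y₀ ∧ z = z₀) → u x * v y * w z * D x y z = 0 := by
    intro x y z hne
    by_cases hu0 : u x = 0
    · simp [hu0]
    by_cases hv0 : v y = 0
    · simp [hv0]
    by_cases hw0 : w z = 0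
    · simp [hw0]
    by_cases hd : D x y z = 0
    · simp [hd]
    have hxle : ex x ≤ ex x₀ := not_lt.1 fun hlt => hu0 (hua x hlt)
    have hyle : ey y ≤ ey y₀ := not_lt.1 fun hlt => hv0 (hva y hlt)
    have hzle : ez z ≤ ez z₀ := not_lt.1 fun hlt => hw0 (hwa z hlt)
    exact absurd (hanti x y z x₀ y₀ z₀ hd hD0 hxle hyle hzle) hne
  have hsum : ∑ x, ∑ y, ∑ z, u x * v y * w z * D x y z = u x₀ * v y₀ * w z₀ * D x₀ y₀ z₀ := by
    have h3 : ∀ x y, ¬ (x = x₀ ∧ y = y₀) → ∑ z, u x * v y * w z * D x y z = 0 := fun x y hxy =>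
      Finset.sum_eq_zero fun z _ => hvan x y z fun h => hxy ⟨h.1, h.2.1⟩
    rw [Finset.sum_eq_single_of_mem x₀ (mem_univ _) fun x _ hx =>
      Finset.sum_eq_zero fun y _ => h3 x y fun h => hx h.1]
    rw [Finset.sum_eq_single_of_mem y₀ (mem_univ _) fun y _ hy => h3 x₀ y fun h => hy h.2]
    exact Finset.sum_eq_single_of_mem z₀ (mem_univ _) fun z _ hz => hvan x₀ y₀ z fun h => hz h.2.2
  rw [hsum] at htri
  exact mul_ne_zero (mul_ne_zero (mul_ne_zero hux hvy) hwz) hD0 htri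

end Literature.Combinatorics.Additive

end
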